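import Summits.Ventures.GridStability.Models.InverterDVOCQuotient

/-!
# GridStability/Models/InverterDVOCQuotient3 — the dVOC network quotient dynamics for `N = 3` (rung G3.c, T3′ «DVOC3-GCBD19-9bus»; general-`N` blocks)

Cell `gridfusion` (LADDER-GRIDFUSION, APEX LINE rung G3.c; lead RULING «T3′ FORM» 00:52:48Z asked
model-3 whether the `N = 2` quotient/invariant construction of `InverterDVOCQuotient.lean` (p467971)
extends to `N = 3` «in one file (orbit ↦ point, sos-3's D driver verbatim)» — it does, this is the
file; seat gridfusion-model-3 (g3). THREE COLUMNS: MODELLED column — exact algebra on the typed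
reduced dVOC network `InverterDVOC.DvocNetwork` (p465594, [cite: SuboticEtAl2021, eq. (ss.f.vhat)]);
no certificate, no stability claim.

## General `N` (§1): the blocks and the closed form of the Lie derivatives

With `P_k = (cos κ p_k* + sin κ q_k*)/v_k*²`, `Q_k = (sin κ p_k* − cos κ q_k*)/v_k*²` (`ctlP`, `ctlQ`:
`K_k = P_k I₂ + Q_k J`), `A_kj = cos κ Yre_kj − sin κ Yim_kj`, `B_kj = cos κ Yim_kj + sin κ Yre_kj`
(`netA`, `netB`: the blocks of `ℛ(κ)𝒴`), `Φ_k = 1 − ρ_k/v_k*²`, the field reads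
`dv̂_k/dt = η[(P_k + η_aΦ_k) v̂_k + Q_k J v̂_k − Σ_i (A_ki v̂_i + B_ki J v̂_i)]`, and the invariants
`ρ_k = |v̂_k|²`, `ξ_kj = ⟨v̂_k, v̂_j⟩`, `ζ_kj = v̂_k ∧ v̂_j` (`ξ_jk = ξ_kj`, `ζ_jk = −ζ_kj`, `ξ_kk = ρ_k`,
`ζ_kk = 0`) satisfy, for EVERY `N` (degree 2 in the invariants):
* `ρ̇_k = 2η[(P_k + η_aΦ_k)ρ_k − Σ_i (A_ki ξ_ki − B_ki ζ_ki)]`,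
* `ξ̇_kj = η[(P_k + P_j + η_a(Φ_k + Φ_j)) ξ_kj + (Q_k − Q_j) ζ_kj − Σ_i (A_ki ξ_ij + B_ki ζ_ij + A_ji ξ_ki + B_ji ζ_ik)]`,
* `ζ̇_kj = η[(P_k + P_j + η_a(Φ_k + Φ_j)) ζ_kj + (Q_j − Q_k) ξ_kj − Σ_i (A_ki ζ_ij − B_ki ξ_ij + A_ji ζ_ki + B_ji ξ_ki)]`
(for `N = 2` these are `quotRho0/1`, `quotXi`, `quotZeta` of p467971 verbatim). §2 kernel-checks them
for `N = 3` (`ring`), the size T3′ needs; the general-`N` sum manipulation is left for when a rung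
asks for `N ≥ 4`.

## `N = 3` (§2–§4): quotient field on `ℝ⁹`, syzygies, descent of solutions, transport

Coordinates `r = (ρ₀, ρ₁, ρ₂, ξ₀₁, ξ₀₂, ξ₁₂, ζ₀₁, ζ₀₂, ζ₁₂) ↦ r 0, …, r 8` (`invariants₃`); quotient
field `quotField₃ : ℝ⁹ → ℝ⁹` (degree 2); Lie identities `lie₃` (nine, by `ring`); chain rule
`hasDerivWithinAt_invariants₃`; rank-one SYZYGIES of the Hermitian matrix `v̂v̂*` holding on the
image (equality multipliers for the producer, any subset): pair `ξ_kj² + ζ_kj² = ρ_kρ_j` (×3) and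
triple `ξ₀₁ξ₁₂ − ζ₀₁ζ₁₂ = ρ₁ξ₀₂`, `ξ₀₁ζ₁₂ + ζ₀₁ξ₁₂ = ρ₁ζ₀₂` (orbit space dimension `2N − 1 = 5 = 9 − 4`);
rotation invariance `invariants₃_rotate`; rest configurations ↦ zeros (`quotField₃_invariants_eq_zero`);
and the model-side TRANSPORT `invariants₃_tendsto_of_quotient_roa` (the `N = 3` twin of
`InverterDVOCOrbitRoa` p478570): lyap-1's recast conclusion for the shifted quotient field on any
`M ⊇ {invariants₃ − r⋆}` ⇒ `invariants₃(v̂ t) → r⋆` along every network solution on `[0, ∞)`.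
COST (producer): `V` quadratic in `r` ⇒ `V_pos` Gram 10, `V̇`-identity Gram `C(11,2) = 55` + up to
5 quadratic equality multipliers — L3/L5 kernel lane (not monolithic). MODELLED: MV-6O (+ instance
modifiers: MV-Ω + h12 + κ′ + SYNTHETIC set-points for «DVOC3-GCBD19-9bus», lead «T3′ FORM»).
-/

noncomputable section

open Real Finset Set Filter Topology

namespace Summit.Ventures.GridStability.Models.InverterDVOC.DvocNetwork

/-! ## §1 General `N`: blocks of `ℛ(κ)𝒴` and of `K_k`; coordinate derivatives -/

section General

variable {N : ℕ} (W : DvocNetwork N)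

/-- Real (`I₂`) part of the `(k, j)` block of `ℛ(κ)𝒴`: `A_kj = cos κ Yre_kj − sin κ Yim_kj`
(= `blkA` of p467971 for `N = 2`). -/
def netA (k j : Fin N) : ℝ := cos W.κ * W.Yre k j - sin W.κ * W.Yim k j

/-- `J` part of the `(k, j)` block of `ℛ(κ)𝒴`: `B_kj = cos κ Yim_kj + sin κ Yre_kj` (= `blkB`). -/
def netB (k j : Fin N) : ℝ := cos W.κ * W.Yim k j + sin W.κ * W.Yre k j

/-- `I₂` part of `K_k = (1/v_k*²)R(κ)(p_k* I − q_k* J)`: `P_k = (cos κ p_k* + sin κ q_k*)/v_k*²` (= `gainP`). -/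
def ctlP (k : Fin N) : ℝ := (cos W.κ * W.pref k + sin W.κ * W.qref k) / W.vref k ^ 2

/-- `J` part of `K_k`: `Q_k = (sin κ p_k* − cos κ q_k*)/v_k*²` (= `gainQ`). -/
def ctlQ (k : Fin N) : ℝ := (sin W.κ * W.pref k - cos W.κ * W.qref k) / W.vref k ^ 2

variable {γ : ℝ → State N} {s : Set ℝ} {t : ℝ}

/-- Coordinate derivatives of a solution, general `N`: `x_k` has derivative `(f^s)_{k,1}`. -/
theorem hasDerivWithinAt_fst' (hγ : HasDerivWithinAt γ (W.field (γ t)) s t) (k : Fin N) :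
    HasDerivWithinAt (fun τ => (γ τ).1 k) (W.dv₁ (γ t) k) s t := by
  have h1 : HasDerivWithinAt (fun τ => (γ τ).1) (W.field (γ t)).1 s t := by
    simpa using hγ.hasFDerivWithinAt.fst.hasDerivWithinAt
  simpa [field] using (hasDerivWithinAt_pi.1 h1) k

/-- Coordinate derivatives of a solution, general `N`: `y_k` has derivative `(f^s)_{k,2}`. -/
theorem hasDerivWithinAt_snd' (hγ : HasDerivWithinAt γ (W.field (γ t)) s t) (k : Fin N) :
    HasDerivWithinAt (fun τ => (γ τ).2 k) (W.dv₂ (γ t) k) s t := by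
  have h2 : HasDerivWithinAt (fun τ => (γ τ).2) (W.field (γ t)).2 s t := by
    simpa using hγ.hasFDerivWithinAt.snd.hasDerivWithinAt
  simpa [field] using (hasDerivWithinAt_pi.1 h2) k

/-- Product rule for `ρ_k = x_k² + y_k²` along a solution (raw form, general `N`). -/
theorem hasDerivWithinAt_rho' (hγ : HasDerivWithinAt γ (W.field (γ t)) s t) (k : Fin N) :
    HasDerivWithinAt (fun τ => rho (γ τ) k)
      (2 * ((γ t).1 k * W.dv₁ (γ t) k + (γ t).2 k * W.dv₂ (γ t) k)) s t := by
  have key := ((W.hasDerivWithinAt_fst' hγ k).mul (W.hasDerivWithinAt_fst' hγ k)).add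
    ((W.hasDerivWithinAt_snd' hγ k).mul (W.hasDerivWithinAt_snd' hγ k))
  have hf : (fun τ => rho (γ τ) k) = fun τ => (γ τ).1 k * (γ τ).1 k + (γ τ).2 k * (γ τ).2 k := by
    funext τ; simp only [rho]; ring
  rw [hf]
  refine key.congr_deriv ?_
  ring

/-- Product rule for `ξ_kj = x_k x_j + y_k y_j` along a solution (raw form, general `N`). -/
theorem hasDerivWithinAt_xi' (hγ : HasDerivWithinAt γ (W.field (γ t)) s t) (k j : Fin N) :
    HasDerivWithinAt (fun τ => xi (γ τ) k j)
      (W.dv₁ (γ t) k * (γ t).1 j + (γ t).1 k * W.dv₁ (γ t) j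
        + (W.dv₂ (γ t) k * (γ t).2 j + (γ t).2 k * W.dv₂ (γ t) j)) s t := by
  have key := ((W.hasDerivWithinAt_fst' hγ k).mul (W.hasDerivWithinAt_fst' hγ j)).add
    ((W.hasDerivWithinAt_snd' hγ k).mul (W.hasDerivWithinAt_snd' hγ j))
  have hf : (fun τ => xi (γ τ) k j) = fun τ => (γ τ).1 k * (γ τ).1 j + (γ τ).2 k * (γ τ).2 j := by
    funext τ; simp only [xi]
  rw [hf]
  exact key

/-- Product rule for `ζ_kj = x_k y_j − y_k x_j` along a solution (raw form, general `N`). -/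
theorem hasDerivWithinAt_zeta' (hγ : HasDerivWithinAt γ (W.field (γ t)) s t) (k j : Fin N) :
    HasDerivWithinAt (fun τ => zeta (γ τ) k j)
      (W.dv₁ (γ t) k * (γ t).2 j + (γ t).1 k * W.dv₂ (γ t) j
        - (W.dv₂ (γ t) k * (γ t).1 j + (γ t).2 k * W.dv₁ (γ t) j)) s t := by
  have key := ((W.hasDerivWithinAt_fst' hγ k).mul (W.hasDerivWithinAt_snd' hγ j)).sub
    ((W.hasDerivWithinAt_snd' hγ k).mul (W.hasDerivWithinAt_fst' hγ j))
  have hf : (fun τ => zeta (γ τ) k j) = fun τ => (γ τ).1 k * (γ τ).2 j - (γ τ).2 k * (γ τ).1 j := by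
    funext τ; simp only [zeta]
  rw [hf]
  exact key

end General

/-! ## §2 `N = 3`: the quotient field on `ℝ⁹` and the nine Lie identities -/

section ThreeConverters

variable (W : DvocNetwork 3)

/-- The quotient vector field `G : ℝ⁹ → ℝ⁹` of the 3-converter dVOC network on
`r = (ρ₀, ρ₁, ρ₂, ξ₀₁, ξ₀₂, ξ₁₂, ζ₀₁, ζ₀₂, ζ₁₂)` (indices `0..8`), written from the general-`N` closed
form of the header with `ξ_jk = ξ_kj`, `ζ_jk = −ζ_kj`, `ξ_kk = ρ_k`, `ζ_kk = 0`. Degree 2. -/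
def quotField₃ (r : Fin 9 → ℝ) : Fin 9 → ℝ :=
  ![
    2 * W.η * ((W.ctlP 0 + W.ηa * (1 - r 0 / W.vref 0 ^ 2)) * r 0 - ((W.netA 0 0 * r 0 - W.netB 0 0 * 0) + (W.netA 0 1 * r 3 - W.netB 0 1 * r 6) + (W.netA 0 2 * r 4 - W.netB 0 2 * r 7))),
    2 * W.η * ((W.ctlP 1 + W.ηa * (1 - r 1 / W.vref 1 ^ 2)) * r 1 - ((W.netA 1 0 * r 3 - W.netB 1 0 * (-r 6)) + (W.netA 1 1 * r 1 - W.netB 1 1 * 0) + (W.netA 1 2 * r 5 - W.netB 1 2 * r 8))),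
    2 * W.η * ((W.ctlP 2 + W.ηa * (1 - r 2 / W.vref 2 ^ 2)) * r 2 - ((W.netA 2 0 * r 4 - W.netB 2 0 * (-r 7)) + (W.netA 2 1 * r 5 - W.netB 2 1 * (-r 8)) + (W.netA 2 2 * r 2 - W.netB 2 2 * 0))),
    W.η * ((W.ctlP 0 + W.ctlP 1 + W.ηa * ((1 - r 0 / W.vref 0 ^ 2) + (1 - r 1 / W.vref 1 ^ 2))) * r 3 + (W.ctlQ 0 - W.ctlQ 1) * r 6 - ((W.netA 0 0 * r 3 + W.netB 0 0 * r 6 + W.netA 1 0 * r 0 + W.netB 1 0 * 0) + (W.netA 0 1 * r 1 + W.netB 0 1 * 0 + W.netA 1 1 * r 3 + W.netB 1 1 * (-r 6)) + (W.netA 0 2 * r 5 + W.netB 0 2 * (-r 8) + W.netA 1 2 * r 4 + W.netB 1 2 * (-r 7)))),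
    W.η * ((W.ctlP 0 + W.ctlP 2 + W.ηa * ((1 - r 0 / W.vref 0 ^ 2) + (1 - r 2 / W.vref 2 ^ 2))) * r 4 + (W.ctlQ 0 - W.ctlQ 2) * r 7 - ((W.netA 0 0 * r 4 + W.netB 0 0 * r 7 + W.netA 2 0 * r 0 + W.netB 2 0 * 0) + (W.netA 0 1 * r 5 + W.netB 0 1 * r 8 + W.netA 2 1 * r 3 + W.netB 2 1 * (-r 6)) + (W.netA 0 2 * r 2 + W.netB 0 2 * 0 + W.netA 2 2 * r 4 + W.netB 2 2 * (-r 7)))),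
    W.η * ((W.ctlP 1 + W.ctlP 2 + W.ηa * ((1 - r 1 / W.vref 1 ^ 2) + (1 - r 2 / W.vref 2 ^ 2))) * r 5 + (W.ctlQ 1 - W.ctlQ 2) * r 8 - ((W.netA 1 0 * r 4 + W.netB 1 0 * r 7 + W.netA 2 0 * r 3 + W.netB 2 0 * r 6) + (W.netA 1 1 * r 5 + W.netB 1 1 * r 8 + W.netA 2 1 * r 1 + W.netB 2 1 * 0) + (W.netA 1 2 * r 2 + W.netB 1 2 * 0 + W.netA 2 2 * r 5 + W.netB 2 2 * (-r 8)))),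
    W.η * ((W.ctlP 0 + W.ctlP 1 + W.ηa * ((1 - r 0 / W.vref 0 ^ 2) + (1 - r 1 / W.vref 1 ^ 2))) * r 6 + (W.ctlQ 1 - W.ctlQ 0) * r 3 - ((W.netA 0 0 * r 6 - W.netB 0 0 * r 3 + W.netA 1 0 * 0 + W.netB 1 0 * r 0) + (W.netA 0 1 * 0 - W.netB 0 1 * r 1 + W.netA 1 1 * r 6 + W.netB 1 1 * r 3) + (W.netA 0 2 * (-r 8) - W.netB 0 2 * r 5 + W.netA 1 2 * r 7 + W.netB 1 2 * r 4))),
    W.η * ((W.ctlP 0 + W.ctlP 2 + W.ηa * ((1 - r 0 / W.vref 0 ^ 2) + (1 - r 2 / W.vref 2 ^ 2))) * r 7 + (W.ctlQ 2 - W.ctlQ 0) * r 4 - ((W.netA 0 0 * r 7 - W.netB 0 0 * r 4 + W.netA 2 0 * 0 + W.netB 2 0 * r 0) + (W.netA 0 1 * r 8 - W.netB 0 1 * r 5 + W.netA 2 1 * r 6 + W.netB 2 1 * r 3) + (W.netA 0 2 * 0 - W.netB 0 2 * r 2 + W.netA 2 2 * r 7 + W.netB 2 2 * r 4))),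
    W.η * ((W.ctlP 1 + W.ctlP 2 + W.ηa * ((1 - r 1 / W.vref 1 ^ 2) + (1 - r 2 / W.vref 2 ^ 2))) * r 8 + (W.ctlQ 2 - W.ctlQ 1) * r 5 - ((W.netA 1 0 * r 7 - W.netB 1 0 * r 4 + W.netA 2 0 * (-r 6) + W.netB 2 0 * r 3) + (W.netA 1 1 * r 8 - W.netB 1 1 * r 5 + W.netA 2 1 * 0 + W.netB 2 1 * r 1) + (W.netA 1 2 * 0 - W.netB 1 2 * r 2 + W.netA 2 2 * r 8 + W.netB 2 2 * r 5)))]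

/-- The invariant map `v̂ ↦ r = (ρ₀, ρ₁, ρ₂, ξ₀₁, ξ₀₂, ξ₁₂, ζ₀₁, ζ₀₂, ζ₁₂) ∈ ℝ⁹`. -/
def invariants₃ (v : State 3) : Fin 9 → ℝ :=
  ![rho v 0, rho v 1, rho v 2, xi v 0 1, xi v 0 2, xi v 1 2, zeta v 0 1, zeta v 0 2, zeta v 1 2]

/-- The raw chain-rule vector `∇(invariants₃)·f^s` at a state (components = the product-rule
expressions of `hasDerivWithinAt_rho'/xi'/zeta'`). -/
def lieRaw₃ (v : State 3) : Fin 9 → ℝ :=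
  ![
    2 * (v.1 0 * W.dv₁ v 0 + v.2 0 * W.dv₂ v 0),
    2 * (v.1 1 * W.dv₁ v 1 + v.2 1 * W.dv₂ v 1),
    2 * (v.1 2 * W.dv₁ v 2 + v.2 2 * W.dv₂ v 2),
    W.dv₁ v 0 * v.1 1 + v.1 0 * W.dv₁ v 1 + (W.dv₂ v 0 * v.2 1 + v.2 0 * W.dv₂ v 1),
    W.dv₁ v 0 * v.1 2 + v.1 0 * W.dv₁ v 2 + (W.dv₂ v 0 * v.2 2 + v.2 0 * W.dv₂ v 2),
    W.dv₁ v 1 * v.1 2 + v.1 1 * W.dv₁ v 2 + (W.dv₂ v 1 * v.2 2 + v.2 1 * W.dv₂ v 2),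
    W.dv₁ v 0 * v.2 1 + v.1 0 * W.dv₂ v 1 - (W.dv₂ v 0 * v.1 1 + v.2 0 * W.dv₁ v 1),
    W.dv₁ v 0 * v.2 2 + v.1 0 * W.dv₂ v 2 - (W.dv₂ v 0 * v.1 2 + v.2 0 * W.dv₁ v 2),
    W.dv₁ v 1 * v.2 2 + v.1 1 * W.dv₂ v 2 - (W.dv₂ v 1 * v.1 2 + v.2 1 * W.dv₁ v 2)]

/-- **Lie identity, component `ρ₀`** (`N = 3`): the product-rule expression equals the quotient
component evaluated at the invariants — an IDENTITY in the state, kernel-checked by `ring`. -/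
theorem lie₃_0 (v : State 3) : lieRaw₃ W v 0 = W.quotField₃ (invariants₃ v) 0 := by
  simp only [lieRaw₃, quotField₃, invariants₃, dv₁, dv₂, Dvoc.dv₁, Dvoc.dv₂, Dvoc.Kv₁, Dvoc.Kv₂,
    Dvoc.phi, unit, netCur₁, netCur₂, Fin.sum_univ_three, rho, xi, zeta, ctlP, ctlQ, netA, netB,
    Matrix.cons_val_zero, Matrix.cons_val_one, Matrix.cons_val]
  ring

/-- **Lie identity, component `ρ₁`** (`N = 3`): the product-rule expression equals the quotient
component evaluated at the invariants — an IDENTITY in the state, kernel-checked by `ring`. -/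
theorem lie₃_1 (v : State 3) : lieRaw₃ W v 1 = W.quotField₃ (invariants₃ v) 1 := by
  simp only [lieRaw₃, quotField₃, invariants₃, dv₁, dv₂, Dvoc.dv₁, Dvoc.dv₂, Dvoc.Kv₁, Dvoc.Kv₂,
    Dvoc.phi, unit, netCur₁, netCur₂, Fin.sum_univ_three, rho, xi, zeta, ctlP, ctlQ, netA, netB,
    Matrix.cons_val_zero, Matrix.cons_val_one, Matrix.cons_val]
  ring

/-- **Lie identity, component `ρ₂`** (`N = 3`): the product-rule expression equals the quotient
component evaluated at the invariants — an IDENTITY in the state, kernel-checked by `ring`. -/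
theorem lie₃_2 (v : State 3) : lieRaw₃ W v 2 = W.quotField₃ (invariants₃ v) 2 := by
  simp only [lieRaw₃, quotField₃, invariants₃, dv₁, dv₂, Dvoc.dv₁, Dvoc.dv₂, Dvoc.Kv₁, Dvoc.Kv₂,
    Dvoc.phi, unit, netCur₁, netCur₂, Fin.sum_univ_three, rho, xi, zeta, ctlP, ctlQ, netA, netB,
    Matrix.cons_val_zero, Matrix.cons_val_one, Matrix.cons_val]
  ring

/-- **Lie identity, component `ξ₀₁`** (`N = 3`): the product-rule expression equals the quotient
component evaluated at the invariants — an IDENTITY in the state, kernel-checked by `ring`. -/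
theorem lie₃_3 (v : State 3) : lieRaw₃ W v 3 = W.quotField₃ (invariants₃ v) 3 := by
  simp only [lieRaw₃, quotField₃, invariants₃, dv₁, dv₂, Dvoc.dv₁, Dvoc.dv₂, Dvoc.Kv₁, Dvoc.Kv₂,
    Dvoc.phi, unit, netCur₁, netCur₂, Fin.sum_univ_three, rho, xi, zeta, ctlP, ctlQ, netA, netB,
    Matrix.cons_val_zero, Matrix.cons_val_one, Matrix.cons_val]
  ring

/-- **Lie identity, component `ξ₀₂`** (`N = 3`): the product-rule expression equals the quotient
component evaluated at the invariants — an IDENTITY in the state, kernel-checked by `ring`. -/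
theorem lie₃_4 (v : State 3) : lieRaw₃ W v 4 = W.quotField₃ (invariants₃ v) 4 := by
  simp only [lieRaw₃, quotField₃, invariants₃, dv₁, dv₂, Dvoc.dv₁, Dvoc.dv₂, Dvoc.Kv₁, Dvoc.Kv₂,
    Dvoc.phi, unit, netCur₁, netCur₂, Fin.sum_univ_three, rho, xi, zeta, ctlP, ctlQ, netA, netB,
    Matrix.cons_val_zero, Matrix.cons_val_one, Matrix.cons_val]
  ring

/-- **Lie identity, component `ξ₁₂`** (`N = 3`): the product-rule expression equals the quotient
component evaluated at the invariants — an IDENTITY in the state, kernel-checked by `ring`. -/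
theorem lie₃_5 (v : State 3) : lieRaw₃ W v 5 = W.quotField₃ (invariants₃ v) 5 := by
  simp only [lieRaw₃, quotField₃, invariants₃, dv₁, dv₂, Dvoc.dv₁, Dvoc.dv₂, Dvoc.Kv₁, Dvoc.Kv₂,
    Dvoc.phi, unit, netCur₁, netCur₂, Fin.sum_univ_three, rho, xi, zeta, ctlP, ctlQ, netA, netB,
    Matrix.cons_val_zero, Matrix.cons_val_one, Matrix.cons_val]
  ring

/-- **Lie identity, component `ζ₀₁`** (`N = 3`): the product-rule expression equals the quotient
component evaluated at the invariants — an IDENTITY in the state, kernel-checked by `ring`. -/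
theorem lie₃_6 (v : State 3) : lieRaw₃ W v 6 = W.quotField₃ (invariants₃ v) 6 := by
  simp only [lieRaw₃, quotField₃, invariants₃, dv₁, dv₂, Dvoc.dv₁, Dvoc.dv₂, Dvoc.Kv₁, Dvoc.Kv₂,
    Dvoc.phi, unit, netCur₁, netCur₂, Fin.sum_univ_three, rho, xi, zeta, ctlP, ctlQ, netA, netB,
    Matrix.cons_val_zero, Matrix.cons_val_one, Matrix.cons_val]
  ring

/-- **Lie identity, component `ζ₀₂`** (`N = 3`): the product-rule expression equals the quotient
component evaluated at the invariants — an IDENTITY in the state, kernel-checked by `ring`. -/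
theorem lie₃_7 (v : State 3) : lieRaw₃ W v 7 = W.quotField₃ (invariants₃ v) 7 := by
  simp only [lieRaw₃, quotField₃, invariants₃, dv₁, dv₂, Dvoc.dv₁, Dvoc.dv₂, Dvoc.Kv₁, Dvoc.Kv₂,
    Dvoc.phi, unit, netCur₁, netCur₂, Fin.sum_univ_three, rho, xi, zeta, ctlP, ctlQ, netA, netB,
    Matrix.cons_val_zero, Matrix.cons_val_one, Matrix.cons_val]
  ring

/-- **Lie identity, component `ζ₁₂`** (`N = 3`): the product-rule expression equals the quotient
component evaluated at the invariants — an IDENTITY in the state, kernel-checked by `ring`. -/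
theorem lie₃_8 (v : State 3) : lieRaw₃ W v 8 = W.quotField₃ (invariants₃ v) 8 := by
  simp only [lieRaw₃, quotField₃, invariants₃, dv₁, dv₂, Dvoc.dv₁, Dvoc.dv₂, Dvoc.Kv₁, Dvoc.Kv₂,
    Dvoc.phi, unit, netCur₁, netCur₂, Fin.sum_univ_three, rho, xi, zeta, ctlP, ctlQ, netA, netB,
    Matrix.cons_val_zero, Matrix.cons_val_one, Matrix.cons_val]
  ring

/-- **The nine Lie identities packaged**: `∇(invariants₃)·f^s (v̂) = G(invariants₃ v̂)`. -/
theorem lie₃ (v : State 3) : lieRaw₃ W v = W.quotField₃ (invariants₃ v) := by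
  ext i
  fin_cases i
  · exact W.lie₃_0 v
  · exact W.lie₃_1 v
  · exact W.lie₃_2 v
  · exact W.lie₃_3 v
  · exact W.lie₃_4 v
  · exact W.lie₃_5 v
  · exact W.lie₃_6 v
  · exact W.lie₃_7 v
  · exact W.lie₃_8 v

/-! ## §3 Syzygies, rotation invariance, descent of solutions -/

/-- The image of `invariants₃` satisfies the rank-one SYZYGIES of `v̂v̂*`: the three pair relations
`ξ_kj² + ζ_kj² = ρ_kρ_j` and the two triple relations `ξ₀₁ξ₁₂ − ζ₀₁ζ₁₂ = ρ₁ξ₀₂`,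
`ξ₀₁ζ₁₂ + ζ₀₁ξ₁₂ = ρ₁ζ₀₂` — the equality constraints `h_j(r) = 0` available to the producer
(any subset; all hold on the image). [folklore] -/
theorem invariants₃_syzygy (v : State 3) :
    invariants₃ v 3 ^ 2 + invariants₃ v 6 ^ 2 = invariants₃ v 0 * invariants₃ v 1 ∧
    invariants₃ v 4 ^ 2 + invariants₃ v 7 ^ 2 = invariants₃ v 0 * invariants₃ v 2 ∧
    invariants₃ v 5 ^ 2 + invariants₃ v 8 ^ 2 = invariants₃ v 1 * invariants₃ v 2 ∧
    invariants₃ v 3 * invariants₃ v 5 - invariants₃ v 6 * invariants₃ v 8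
      = invariants₃ v 1 * invariants₃ v 4 ∧
    invariants₃ v 3 * invariants₃ v 8 + invariants₃ v 6 * invariants₃ v 5
      = invariants₃ v 1 * invariants₃ v 7 := by
  simp only [invariants₃, rho, xi, zeta, Matrix.cons_val_zero, Matrix.cons_val_one,
    Matrix.cons_val]
  refine ⟨by ring, by ring, by ring, by ring, by ring⟩

/-- Magnitude entries are nonnegative: `ρ_k ≥ 0` (orthant conjuncts for the producer's domain). -/
theorem invariants₃_rho_nonneg (v : State 3) :
    0 ≤ invariants₃ v 0 ∧ 0 ≤ invariants₃ v 1 ∧ 0 ≤ invariants₃ v 2 := by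
  simp only [invariants₃, Matrix.cons_val_zero, Matrix.cons_val_one, Matrix.cons_val]
  exact ⟨by simp [rho]; positivity, by simp [rho]; positivity, by simp [rho]; positivity⟩

/-- `invariants₃` is constant on `ℛ(θ)`-orbits (it descends to the quotient). -/
theorem invariants₃_rotate (θ : ℝ) (v : State 3) : invariants₃ (rotate θ v) = invariants₃ v := by
  ext i
  fin_cases i <;> simp [invariants₃, rho_rotate, xi_rotate, zeta_rotate]

/-- `invariants₃` is continuous (polynomial). -/
theorem continuous_invariants₃ : Continuous (invariants₃ : State 3 → Fin 9 → ℝ) := by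
  refine continuous_pi fun i => ?_
  fin_cases i <;> simp [invariants₃, rho, xi, zeta] <;> fun_prop

variable {γ : ℝ → State 3} {s : Set ℝ} {t : ℝ}

/-- **Chain rule (`N = 3`).** Along every solution `γ` of the reduced dVOC network (tree convention:
`HasDerivWithinAt γ (field (γ t)) s t`), the invariant curve `t ↦ r(t) = invariants₃ (γ t)` solves the
quotient ODE `dr/dt = G(r(t))` within `s` — so an SOS certificate for the 9-variable quotient field on
the syzygy variety is a statement about every solution of the network MODEL, modulo the common
rotation. MODELLED: MV-6O. -/
theorem hasDerivWithinAt_invariants₃ (hγ : HasDerivWithinAt γ (W.field (γ t)) s t) :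
    HasDerivWithinAt (fun τ => invariants₃ (γ τ)) (W.quotField₃ (invariants₃ (γ t))) s t := by
  rw [← W.lie₃ (γ t)]
  refine hasDerivWithinAt_pi.2 fun i => ?_
  fin_cases i
  · simpa [invariants₃, lieRaw₃] using W.hasDerivWithinAt_rho' hγ 0
  · simpa [invariants₃, lieRaw₃] using W.hasDerivWithinAt_rho' hγ 1
  · simpa [invariants₃, lieRaw₃] using W.hasDerivWithinAt_rho' hγ 2
  · simpa [invariants₃, lieRaw₃] using W.hasDerivWithinAt_xi' hγ 0 1
  · simpa [invariants₃, lieRaw₃] using W.hasDerivWithinAt_xi' hγ 0 2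
  · simpa [invariants₃, lieRaw₃] using W.hasDerivWithinAt_xi' hγ 1 2
  · simpa [invariants₃, lieRaw₃] using W.hasDerivWithinAt_zeta' hγ 0 1
  · simpa [invariants₃, lieRaw₃] using W.hasDerivWithinAt_zeta' hγ 0 2
  · simpa [invariants₃, lieRaw₃] using W.hasDerivWithinAt_zeta' hγ 1 2

/-- Rest configurations of `f^s` map to zeros of the quotient field (the whole `ℛ(θ)`-orbit of a rest
configuration is ONE rest point `r⋆` of `G`). -/
theorem quotField₃_invariants_eq_zero {v : State 3} (h : W.field v = 0) :
    W.quotField₃ (invariants₃ v) = 0 := by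
  have h1 : ∀ k, W.dv₁ v k = 0 := fun k => by
    have := congrArg (fun f => f.1 k) h
    simpa [field] using this
  have h2 : ∀ k, W.dv₂ v k = 0 := fun k => by
    have := congrArg (fun f => f.2 k) h
    simpa [field] using this
  rw [← W.lie₃ v]
  ext i
  fin_cases i <;> simp [lieRaw₃, h1, h2]

/-! ## §4 Model-side transport (`N = 3` twin of `InverterDVOCOrbitRoa`) -/

/-- **Rung G3.c / T3′ transport, generic in the certificate (`N = 3`).** For `r⋆ ∈ ℝ⁹`, ANY field
`F` with `F (r − r⋆) = quotField₃ W r` (the Bench field = the shifted quotient field), ANY `M`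
containing every shifted invariant vector, ANY `Vz`, `c`: lyap-1's recast conclusion for curves `x`
on `[0, ∞)` with `ẋ = F(x)` staying in `M` («`Vz(x t) ≤ c` persists and `x t → 0`») implies, along
every network solution `v̂` on `[0, ∞)` with `Vz(invariants₃ v̂(0) − r⋆) ≤ c`: the bound persists and
`invariants₃ v̂(t) → r⋆` — convergence to the rest ORBIT `{invariants₃ = r⋆}`. MODELLED: MV-6O.
No sentence here says a converter is stable. [folklore] -/
theorem invariants₃_tendsto_of_quotient_roa (rstar : Fin 9 → ℝ)
    {F : (Fin 9 → ℝ) → Fin 9 → ℝ} (hF : ∀ r : Fin 9 → ℝ, F (r - rstar) = W.quotField₃ r)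
    {M : Set (Fin 9 → ℝ)} (hM : ∀ v : State 3, invariants₃ v - rstar ∈ M)
    {Vz : (Fin 9 → ℝ) → ℝ} {c : ℝ}
    (hroa : ∀ x : ℝ → Fin 9 → ℝ, ContinuousOn x (Ici 0) →
      (∀ t, 0 ≤ t → HasDerivWithinAt x (F (x t)) (Ici t) t) → (∀ t, 0 ≤ t → x t ∈ M) →
      Vz (x 0) ≤ c → (∀ t, 0 ≤ t → Vz (x t) ≤ c) ∧ Tendsto x atTop (𝓝 0))
    {v : ℝ → State 3} (hv : W.IsSolutionOn v (Ici 0))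
    (h0 : Vz (invariants₃ (v 0) - rstar) ≤ c) :
    (∀ t, 0 ≤ t → Vz (invariants₃ (v t) - rstar) ≤ c) ∧
      Tendsto (fun t => invariants₃ (v t)) atTop (𝓝 rstar) := by
  set x : ℝ → Fin 9 → ℝ := fun τ => invariants₃ (v τ) - rstar with hxdef
  have hvc : ContinuousOn v (Ici 0) := fun t ht => (hv t ht).continuousWithinAt
  have hxc : ContinuousOn x (Ici 0) :=
    (continuous_invariants₃.comp_continuousOn hvc).sub continuousOn_const
  have hx : ∀ t, 0 ≤ t → HasDerivWithinAt x (F (x t)) (Ici t) t := by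
    intro t ht
    have h := ((W.hasDerivWithinAt_invariants₃ (hv t ht)).sub_const rstar).mono
      (Ici_subset_Ici.2 ht)
    have hFt : F (x t) = W.quotField₃ (invariants₃ (v t)) := hF (invariants₃ (v t))
    rw [hFt]
    exact h
  have hxM : ∀ t, 0 ≤ t → x t ∈ M := fun t _ => hM (v t)
  obtain ⟨hinv, hlim⟩ := hroa x hxc hx hxM h0
  refine ⟨hinv, ?_⟩
  have h := hlim.add_const rstar
  simp only [zero_add] at h
  refine h.congr fun t => ?_
  simp [hxdef]

end ThreeConverters

end Summit.Ventures.GridStability.Models.InverterDVOC.DvocNetwork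

end
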